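import Summits.KontsevichZagierPeriods.KontsevichZagierPeriods.Theses.CarlsonRule
import Literature.NumberTheory.Transcendental.KZLogCalculusProofs

/-!
# `CarlsonClosure` (stmt-KontsevichZagierPeriods-12256, route CarlsonRule) — line "lacunary_moments"

Strategist's ALTERNATIVE line (registered alongside `Lines/birth.lean`, never overwriting it).

THE LACUNARY MOMENT NORMAL FORM.  Unfold the radical `g^{1/q}` into a FIBRE VARIABLE `u` (the band
`0 ≤ u ≤ g(x)^{1/q}` over `σ ∩ {f ≠ 0}`, Kontsevich–Zagier's "more variables" device, one
Newton–Leibniz move with the POLYNOMIAL primitive `f(x)·u^{j+1}`):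

  `[σ, f·g^{(j+1)/q}] ∼ [Lift_q σ, (j+1)·f(x)·u^j]`      (`stub_liftRelation`, `stub_liftRepsExist`).

After the lift, ALL data of Carlson's rule live on ONE pair of domains `(Lift_q σ, Lift_q τ)`, every
integrand is an INTEGER monomial `(j+1)·F·u^j` in the last coordinate (no `Real.rpow`, no `g`), the
integer-exponent premisses `m ≥ 1` become the LACUNARY moments `j + 1 ∈ qℕ`, and the conclusion at
`k = p/q` is the moment `j = p − 1`.  The normalisation `(j+1)·u^j = d(u^{j+1})/du` makes every
transition scalar-free (the formal group is a `ℤ`-module and division by integers is not a rule —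
cf. the open support item `TorsionFree` of routes ExponentCosets/CoactionDevissage).  The open core is
then ONE statement in the polynomial sub-calculus:

  `LacunaryMomentRule q` : for moment families `ρ j = [S, (j+1)·F·u^j]`, `ρ' j = [T, (j+1)·F'·u^j]`
  (`0 ≤ u ≤ L` on `S`, `T`; `F`, `F'` ARBITRARY), congruence `[ρ j] ∼ [ρ' j]` along the lacunary set
  `j + 1 ∈ qℕ` implies congruence for every `j ∈ ℕ`            (`stub_lacunaryMomentRule`, q ≥ 2).

`CarlsonClosure_of : stub₁-sig → stub₂-sig → stub₃-sig → CarlsonClosure` is sorry-free (integer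
exponents `k ∈ ℕ` are handled directly from the `k`-th premiss, as in §7 of
`Cruxes/CarlsonKernel/Attack.lean`; fractional `k = p/q`, `q ≥ 2`, go through the lift at `j = p − 1`).
Value-level soundness of `LacunaryMomentRule q`: the substitution `t = u^q` turns the lacunary
moments of `u_*(F dz)` on `[0, L]` into ALL moments of the finite measure `t^{1−1/q}·(u^q)_*(F dz)`,
so Hausdorff/Weierstrass determinacy (`setIntegral_comp_eq_of_moments_eq`, Attack.lean §9) applies;
hence `KontsevichZagierPeriods → LacunaryMomentRule q` exactly as for the crux, and a refutation of the
stub refutes the summit.  See `Lines/lacunary_moments.md` for the card (why-easier, barriers, probes).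
-/

set_option linter.dupNamespace false

noncomputable section

namespace Summit.KontsevichZagierPeriods.KontsevichZagierPeriods.Cruxes.CarlsonClosure.LacunaryMoments

open Set
open Literature.NumberTheory.Transcendental
open Summit.KontsevichZagierPeriods.KontsevichZagierPeriods.Theses.CarlsonRule (CarlsonClosure)

/-! ## Vocabulary -/

/-- A MOMENT FAMILY on `S ⊆ ℝ^{N+1}` with weight `F`: `ρ j = [S, (j+1)·F·u^j]`, `u` the last
coordinate (`(j+1)·u^j = d(u^{j+1})/du`, the scalar-free normalisation). [cite: KontsevichZagier2001, §1.1] -/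
def IsMomentFamily (N : ℕ) (S : Set (Fin (N + 1) → ℝ)) (F : (Fin (N + 1) → ℝ) → ℝ)
    (ρ : ℕ → KZ.IntegralRep (N + 1)) : Prop :=
  ∀ j : ℕ, (ρ j).domain = S ∧
    EqOn (ρ j).integrand (fun z => ((j : ℝ) + 1) * F z * z (Fin.last N) ^ j) S

/-- THE LACUNARY MOMENT RULE at modulus `q`: for two moment families over domains on which the last
coordinate is bounded (`0 ≤ u ≤ L`), congruence modulo `KZ.relations` along the lacunary exponents
`j + 1 ∈ qℕ` implies congruence at every exponent `j`.  (`q = 1`: tautology, `lacunaryMomentRule_one`;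
`q = 0`: false; the stub asks `q ≥ 2`.) [cite: KontsevichZagier2001, §1.2] -/
def LacunaryMomentRule (q : ℕ) : Prop :=
  ∀ (N N' : ℕ) (S : Set (Fin (N + 1) → ℝ)) (T : Set (Fin (N' + 1) → ℝ))
    (F : (Fin (N + 1) → ℝ) → ℝ) (F' : (Fin (N' + 1) → ℝ) → ℝ) (L : ℝ)
    (ρ : ℕ → KZ.IntegralRep (N + 1)) (ρ' : ℕ → KZ.IntegralRep (N' + 1)),
    (∀ z ∈ S, 0 ≤ z (Fin.last N) ∧ z (Fin.last N) ≤ L) →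
    (∀ w ∈ T, 0 ≤ w (Fin.last N') ∧ w (Fin.last N') ≤ L) →
    IsMomentFamily N S F ρ → IsMomentFamily N' T F' ρ' →
    (∀ j m : ℕ, j + 1 = q * m → KZ.of (ρ j) - KZ.of (ρ' j) ∈ KZ.relations) →
    ∀ j : ℕ, KZ.of (ρ j) - KZ.of (ρ' j) ∈ KZ.relations

/-- THE LIFT DOMAIN `Lift_q σ = {(x, u) | x ∈ σ, f x ≠ 0, 0 ≤ u ≤ g(x)^{1/q}}`: the band (shape of
rule 3) over the support of `f` in `σ` with edges `0` and the `q`-th root of `g`.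
[cite: KontsevichZagier2001, §1.1] -/
def liftDom {n : ℕ} (q : ℕ) (σ : Set (Fin n → ℝ)) (f g : (Fin n → ℝ) → ℝ) :
    Set (Fin (n + 1) → ℝ) :=
  KZlog.band {x | x ∈ σ ∧ f x ≠ 0} (fun _ => (0 : ℝ)) (fun x => g x ^ ((1 : ℝ) / (q : ℝ)))

/-- ONE SIDE of the premisses of Carlson's rule (verbatim sub-formula of the crux): the bound
`0 ≤ g ≤ M` on `σ` and the integer-moment family `r m = [σ, f·g^m]` of genuine representations.
[cite: KontsevichZagier2001, §1.2] -/
def HalfPrem (n : ℕ) (σ : Set (Fin n → ℝ)) (f g : (Fin n → ℝ) → ℝ) (M : ℝ)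
    (r : ℕ → KZ.IntegralRep n) : Prop :=
  (∀ x ∈ σ, 0 ≤ g x ∧ g x ≤ M) ∧
  (∀ m, (r m).domain = σ ∧ EqOn (r m).integrand (fun x => f x * g x ^ m) σ)

/-- LIFT REPRESENTATIONS EXIST: under one side of the premisses, the moment family
`j ↦ [Lift_q σ, (j+1)·f(x)·u^j]` consists of Kontsevich–Zagier integral representations
(ℚ-semialgebraic band: `f = (r 0).integrand`, `g = (r 1).integrand / (r 0).integrand` on `{f ≠ 0}`,
`KZlog.isSemialgebraic_band`, `IsSemialgebraicFunOn.rpow_ratCast_of_nonneg`; integrable: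
fibre integral `|f| g^{(j+1)/q} ≤ max(1,M)^{j+1} |f|`, `KZlog.integrableOn_band_of_lintegral_fibre_le`).
[cite: KontsevichZagier2001, §1.1] -/
def LiftRepsExist : Prop :=
  ∀ (n : ℕ) (σ : Set (Fin n → ℝ)) (f g : (Fin n → ℝ) → ℝ) (M : ℝ) (r : ℕ → KZ.IntegralRep n),
    HalfPrem n σ f g M r → ∀ q : ℕ, 1 ≤ q →
      ∃ ρ : ℕ → KZ.IntegralRep (n + 1),
        IsMomentFamily n (liftDom q σ f g) (fun z => f (Fin.init z)) ρ

/-- THE LIFT RELATION (one Newton–Leibniz move, rule 3, with the POLYNOMIAL primitive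
`f(x)·u^{j+1}` on the band `Lift_q σ`, edges `0 ≤ g^{1/q}`; plus domain additivity off the support
of `f`, where the integrand vanishes): `[σ, f·g^{(j+1)/q}] − [Lift_q σ, (j+1)·f(x)·u^j] ∈ KZ.relations`.
[cite: KontsevichZagier2001, §1.2] -/
def LiftRelation : Prop :=
  ∀ (n : ℕ) (σ : Set (Fin n → ℝ)) (f g : (Fin n → ℝ) → ℝ) (M : ℝ) (r : ℕ → KZ.IntegralRep n),
    HalfPrem n σ f g M r → ∀ q j : ℕ, 1 ≤ q →
      ∀ (rk : KZ.IntegralRep n) (ρ : KZ.IntegralRep (n + 1)),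
        rk.domain = σ →
        EqOn rk.integrand (fun x => f x * g x ^ (((j + 1 : ℕ) : ℝ) / (q : ℝ))) σ →
        ρ.domain = liftDom q σ f g →
        EqOn ρ.integrand (fun z => ((j : ℝ) + 1) * f (Fin.init z) * z (Fin.last n) ^ j)
          (liftDom q σ f g) →
        KZ.of rk - KZ.of ρ ∈ KZ.relations

/-! ## Obligation nodes (the stub signatures, named by their stubs) -/

namespace Obligation

/-- Obligation node of `stub_liftRepsExist`. [cite: KontsevichZagier2001, §1.1] -/
def stub_liftRepsExist : Prop := LiftRepsExist

/-- Obligation node of `stub_liftRelation`. [cite: KontsevichZagier2001, §1.2] -/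
def stub_liftRelation : Prop := LiftRelation

/-- Obligation node of `stub_lacunaryMomentRule` (THE OPEN CORE). [cite: KontsevichZagier2001, §1.2] -/
def stub_lacunaryMomentRule : Prop := ∀ q : ℕ, 2 ≤ q → LacunaryMomentRule q

end Obligation

/-! ## The three registered stubs -/

/-- Stub 1 — LIFT REPRESENTATIONS EXIST (size M–L; semialgebraic geometry of the band + one
integrability estimate; provable now). Why it might fail: only a slip in extracting `f`, `g` as
ℚ-semialgebraic functions from `r 0`, `r 1` (the statement is about `σ ∩ {f ≠ 0}` only).
[cite: KontsevichZagier2001, §1.1] -/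
theorem stub_liftRepsExist : LiftRepsExist := by
  sorry

/-- Stub 2 — THE LIFT RELATION (size L; `KZ.newtonLeibnizRel` with `F(x,u) = f(x)·u^{j+1}`,
`a = 0`, `b = g^{1/q}`, base `σ ∩ {f ≠ 0}`; then `KZ.of_mem_relations_of_eqOn_zero` on `σ ∩ {f = 0}`
and domain additivity, `KZ.of_sub_of_mem_relations_of_eqOn` for the congruences; provable now).
Why it might fail: bookkeeping only (`(g^{1/q})^{j+1} = g^{(j+1)/q}` needs `0 ≤ g`, given).
[cite: KontsevichZagier2001, §1.2] -/
theorem stub_liftRelation : LiftRelation := by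
  sorry

/-- Stub 3 — THE LACUNARY MOMENT RULE for every modulus `q ≥ 2` (THE OPEN CORE; open-problem
grade).  It is Carlson's rule in normal form and slightly MORE: the weight `F` may depend on the
fibre variable.  Why it might fail: it is an ω-rule of the four-move calculus (one finite chain must
be produced from infinitely many unrelated lacunary chains); it implies the crux, hence every
exponent-coset anchor (Gauss multiplication, Opdam's G₂ values); a single additive invariant of
`KZ.FormalRep` killing the four moves and separating one moment pair refutes it — and the summit.
[cite: KontsevichZagier2001, §1.2] -/
theorem stub_lacunaryMomentRule : ∀ q : ℕ, 2 ≤ q → LacunaryMomentRule q := by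
  sorry

/-! ## Glue (proved) -/

/-- `q = 1` is a tautology (the lacunary set is everything): sanity of the vocabulary.
[cite: KontsevichZagier2001, §1.2] -/
theorem lacunaryMomentRule_one : LacunaryMomentRule 1 :=
  fun _ _ _ _ _ _ _ _ _ _ _ _ _ h j => h j (j + 1) (by ring)

/-- THE INTEGER CASE: at an integral exponent `e = m` the conclusion of Carlson's rule follows from
the `m`-th premiss and two congruences (`KZ.of_sub_of_mem_relations_of_eqOn`, `Real.rpow_natCast`)
— §7 of `Cruxes/CarlsonKernel/Attack.lean`, `rootRule_one` of `Lines/birth.lean`.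
[cite: KontsevichZagier2001, §1.2] -/
theorem integer_case {n n' : ℕ} {σ : Set (Fin n → ℝ)} {τ : Set (Fin n' → ℝ)}
    {f g : (Fin n → ℝ) → ℝ} {f' g' : (Fin n' → ℝ) → ℝ}
    {r : ℕ → KZ.IntegralRep n} {s : ℕ → KZ.IntegralRep n'}
    (hr : ∀ m, (r m).domain = σ ∧ EqOn (r m).integrand (fun x => f x * g x ^ m) σ)
    (hs : ∀ m, (s m).domain = τ ∧ EqOn (s m).integrand (fun y => f' y * g' y ^ m) τ)
    (hrel : ∀ m, KZ.of (r m) - KZ.of (s m) ∈ KZ.relations)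
    (m : ℕ) {e : ℝ} (he : e = (m : ℝ)) (rk : KZ.IntegralRep n) (sk : KZ.IntegralRep n')
    (h1 : rk.domain = σ) (h2 : EqOn rk.integrand (fun x => f x * g x ^ e) σ)
    (h3 : sk.domain = τ) (h4 : EqOn sk.integrand (fun y => f' y * g' y ^ e) τ) :
    KZ.of rk - KZ.of sk ∈ KZ.relations := by
  subst he
  have e1 : KZ.of rk - KZ.of (r m) ∈ KZ.relations := by
    refine KZ.of_sub_of_mem_relations_of_eqOn (by rw [(hr m).1, h1]) ?_
    intro x hx
    rw [h1] at hx
    rw [h2 hx, (hr m).2 hx]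
    simp [Real.rpow_natCast]
  have e2 : KZ.of (s m) - KZ.of sk ∈ KZ.relations := by
    refine KZ.of_sub_of_mem_relations_of_eqOn (by rw [(hs m).1, h3]) ?_
    intro y hy
    rw [(hs m).1] at hy
    rw [(hs m).2 hy, h4 hy]
    simp [Real.rpow_natCast]
  have key : KZ.of rk - KZ.of sk =
      (KZ.of rk - KZ.of (r m)) + (KZ.of (r m) - KZ.of (s m)) + (KZ.of (s m) - KZ.of sk) := by abel
  rw [key]
  exact add_mem (add_mem e1 (hrel m)) e2

/-- The last coordinate is bounded by `max 1 M` on a lift domain (`u ≤ g^{1/q}` with `0 ≤ g ≤ M`).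
[cite: KontsevichZagier2001, §1.1] -/
theorem last_mem_of_mem_liftDom {n : ℕ} {q : ℕ} (hq : 1 ≤ q) {σ : Set (Fin n → ℝ)}
    {f g : (Fin n → ℝ) → ℝ} {M : ℝ} (hg : ∀ x ∈ σ, 0 ≤ g x ∧ g x ≤ M)
    {z : Fin (n + 1) → ℝ} (hz : z ∈ liftDom q σ f g) :
    0 ≤ z (Fin.last n) ∧ z (Fin.last n) ≤ max 1 M := by
  obtain ⟨hx, h0, hb⟩ := hz
  refine ⟨h0, hb.trans ?_⟩
  obtain ⟨hg0, hgM⟩ := hg _ hx.1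
  have hq' : (0 : ℝ) ≤ 1 / (q : ℝ) := by positivity
  have hq1 : 1 / (q : ℝ) ≤ 1 := by
    rw [div_le_one (by exact_mod_cast hq)]
    exact_mod_cast hq
  rcases le_or_gt (g (Fin.init z)) 1 with hle | hlt
  · exact (Real.rpow_le_one hg0 hle hq').trans (le_max_left _ _)
  · calc g (Fin.init z) ^ ((1 : ℝ) / (q : ℝ))
        ≤ g (Fin.init z) ^ (1 : ℝ) := Real.rpow_le_rpow_of_exponent_le hlt.le hq1
      _ = g (Fin.init z) := Real.rpow_one _
      _ ≤ max 1 M := hgM.trans (le_max_right _ _)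

/-- `k = num / den` for a rational `k ≥ 0`. [cite: KontsevichZagier2001, §1.2] -/
theorem ratCast_eq_div {k : ℚ} (hk : 0 ≤ k) :
    (k : ℝ) = ((k.num.natAbs : ℕ) : ℝ) / ((k.den : ℕ) : ℝ) := by
  rw [Nat.cast_natAbs, abs_of_nonneg (Rat.num_nonneg.2 hk), Rat.cast_def]

/-! ## Composition -/

/-- **Composition** (sorry-free): lift existence, the lift relation and the lacunary moment rule
(`q ≥ 2`) imply the crux.  Integer `k` (denominator `1`, or numerator `0`): `integer_case`.
Fractional `k = p/q`, `p ≥ 1`, `q ≥ 2`: lift both sides at modulus `q`; the lacunary premiss at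
`j + 1 = q·m` is the `m`-th premiss of the crux transported through two lift relations; the rule's
conclusion at `j = p − 1` is transported back the same way.  Hypotheses: the three obligation nodes
(= stub signatures, by name).  Concludes `…Theses.CarlsonRule.CarlsonClosure` BY NAME.
[cite: KontsevichZagier2001, §1.2] -/
theorem CarlsonClosure_of :
    Obligation.stub_liftRepsExist → Obligation.stub_liftRelation →
    Obligation.stub_lacunaryMomentRule →
    Summit.KontsevichZagierPeriods.KontsevichZagierPeriods.Theses.CarlsonRule.CarlsonClosure := by
  intro hE hR hL n n' σ τ f g f' g' M r s hg hg' hr hs hrel k hk rk sk h1 h2 h3 h4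
  obtain ⟨p, q, hq, hcast⟩ : ∃ p q : ℕ, 1 ≤ q ∧ (k : ℝ) = (p : ℝ) / (q : ℝ) :=
    ⟨k.num.natAbs, k.den, k.den_pos, ratCast_eq_div hk⟩
  by_cases hpq : p = 0 ∨ q = 1
  · -- integral exponent
    obtain ⟨m, hm⟩ : ∃ m : ℕ, (k : ℝ) = (m : ℝ) := by
      rcases hpq with hp0 | hq1
      · exact ⟨0, by rw [hcast, hp0]; simp⟩
      · exact ⟨p, by rw [hcast, hq1]; simp⟩
    exact integer_case hr hs hrel m hm rk sk h1 h2 h3 h4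
  · -- fractional exponent `p / q`, `p ≥ 1`, `q ≥ 2`
    push Not at hpq
    obtain ⟨hp0, hq1⟩ := hpq
    have hq2 : 2 ≤ q := by omega
    have hqR : (q : ℝ) ≠ 0 := by exact_mod_cast (show q ≠ 0 by omega)
    obtain ⟨j, hj⟩ : ∃ j, p = j + 1 := ⟨p - 1, by omega⟩
    rw [hj] at hcast
    -- the two lifts
    obtain ⟨ρ, hρ⟩ := hE n σ f g M r ⟨hg, hr⟩ q hq
    obtain ⟨ρ', hρ'⟩ := hE n' τ f' g' M s ⟨hg', hs⟩ q hq
    -- lacunary premisses on the lifts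
    have hprem : ∀ j' m : ℕ, j' + 1 = q * m → KZ.of (ρ j') - KZ.of (ρ' j') ∈ KZ.relations := by
      intro j' m hjm
      have hexp : (((j' + 1 : ℕ) : ℝ)) / (q : ℝ) = (m : ℝ) := by
        rw [hjm]; push_cast; field_simp
      have e1 : KZ.of (r m) - KZ.of (ρ j') ∈ KZ.relations := by
        refine hR n σ f g M r ⟨hg, hr⟩ q j' hq (r m) (ρ j') (hr m).1 ?_ (hρ j').1 (hρ j').2
        intro x hx
        rw [(hr m).2 hx]
        show f x * g x ^ m = f x * g x ^ ((((j' + 1 : ℕ) : ℝ)) / (q : ℝ))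
        rw [hexp, Real.rpow_natCast]
      have e2 : KZ.of (s m) - KZ.of (ρ' j') ∈ KZ.relations := by
        refine hR n' τ f' g' M s ⟨hg', hs⟩ q j' hq (s m) (ρ' j') (hs m).1 ?_ (hρ' j').1 (hρ' j').2
        intro y hy
        rw [(hs m).2 hy]
        show f' y * g' y ^ m = f' y * g' y ^ ((((j' + 1 : ℕ) : ℝ)) / (q : ℝ))
        rw [hexp, Real.rpow_natCast]
      have key : KZ.of (ρ j') - KZ.of (ρ' j') =
          -(KZ.of (r m) - KZ.of (ρ j')) + (KZ.of (r m) - KZ.of (s m)) +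
            (KZ.of (s m) - KZ.of (ρ' j')) := by abel
      rw [key]
      exact add_mem (add_mem (neg_mem e1) (hrel m)) e2
    -- the rule
    have hconcl := hL q hq2 n n' (liftDom q σ f g) (liftDom q τ f' g')
      (fun z => f (Fin.init z)) (fun w => f' (Fin.init w)) (max 1 M) ρ ρ'
      (fun z hz => last_mem_of_mem_liftDom hq hg hz)
      (fun w hw => last_mem_of_mem_liftDom hq hg' hw) hρ hρ' hprem j
    -- back to the crux's conclusion at `k = (j+1)/q`
    have hk' : (k : ℝ) = (((j + 1 : ℕ) : ℝ)) / (q : ℝ) := by rw [hcast]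
    have e3 : KZ.of rk - KZ.of (ρ j) ∈ KZ.relations := by
      refine hR n σ f g M r ⟨hg, hr⟩ q j hq rk (ρ j) h1 ?_ (hρ j).1 (hρ j).2
      intro x hx
      rw [h2 hx]
      show f x * g x ^ (k : ℝ) = f x * g x ^ ((((j + 1 : ℕ) : ℝ)) / (q : ℝ))
      rw [hk']
    have e4 : KZ.of sk - KZ.of (ρ' j) ∈ KZ.relations := by
      refine hR n' τ f' g' M s ⟨hg', hs⟩ q j hq sk (ρ' j) h3 ?_ (hρ' j).1 (hρ' j).2
      intro y hy
      rw [h4 hy]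
      show f' y * g' y ^ (k : ℝ) = f' y * g' y ^ ((((j + 1 : ℕ) : ℝ)) / (q : ℝ))
      rw [hk']
    have key : KZ.of rk - KZ.of sk =
        (KZ.of rk - KZ.of (ρ j)) + (KZ.of (ρ j) - KZ.of (ρ' j)) - (KZ.of sk - KZ.of (ρ' j)) := by
      abel
    rw [key]
    exact sub_mem (add_mem e3 hconcl) e4

/-- The by-name skeleton theorem (no hypotheses): the three sorried stubs fed into
`CarlsonClosure_of`. [cite: KontsevichZagier2001, §1.2] -/
theorem carlsonClosure_skeleton :
    Summit.KontsevichZagierPeriods.KontsevichZagierPeriods.Theses.CarlsonRule.CarlsonClosure :=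
  CarlsonClosure_of stub_liftRepsExist stub_liftRelation stub_lacunaryMomentRule

end Summit.KontsevichZagierPeriods.KontsevichZagierPeriods.Cruxes.CarlsonClosure.LacunaryMoments
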